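import Literature.Probability.RandomPlanarGeometry.SAWLoopErasureMemoryTwo
import HarnessLib

/-!
# Hara–Slade–Sokal loop erasure with memory `τ = 2`, series level: `μ(ℤ^d) ≥ (2d−1)/Π̃₂(1; 1/(2d−1))` with `Π̃₂`
the maximum over the geometry of the penalised loop GENERATING FUNCTIONS (`d ≥ 3`)

Topic `Literature/Probability/RandomPlanarGeometry`; a child of the tree's `SAWLoopErasureMemoryTwo.lean` (HSS93 (2.39)
with `τ = 2`, `k = 1`: the sets `nbwAvoid`, `lastFiberN`, `closedNbwPen`, the numbers `nbwLoopsAll`, the fibre bounds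
`card_nbwAvoid_le_sum`, `card_lastFiberN_le`, `card_lastFiberN_self_le`, the limit argument
`div_le_connectiveConstant_of`, `one_le_card_nbwWords_mul_pow`, `sum_nbwLoopsAll_mul_pow_le` are used BY NAME, as are
`sawAvoid`, `shiftSet`, `sum_card_sawAvoid_shift_le`, `sum_convolution_mul_pow_le` of `SAWLoopErasureKesten.lean`).

The tree's `hss_memoryTwo_div_le_connectiveConstant` bounds `μ(ℤ^d)` below by `(2d−1)/W` for any bound `W` on the partial
sums of `Σ_j w̃_j β^j`, `w̃_j = nbwLoopsPen d j = max_{t ≠ s} #closedNbwPen {e_t} s j` — the maximum over the geometry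
`(A, e) = ({e_t}, e_s)` taken COEFFICIENT BY COEFFICIENT.  The source takes the maximum of the generating functions
themselves: `Π̃_τ(k;β) = max_{A,e} C̃^{A;e}_τ(0,0;β)` (2.36).  This module re-runs the decoration induction at the level
of (partial sums of) generating functions, so that the hypothesis becomes, AS PRINTED, a bound `W` on EACH geometry's
series `Σ_j #closedNbwPen {e_t} s j β^j` (`t ≠ s`), and proves `μ(ℤ^d) ≥ (2d−1)/W`.  Since `max_{t≠s}` of the series is
at most the series of the coefficientwise maxima, this is never weaker than the tree's statement, and it is what the
evaluation of Table 2, row `(2̃,1)`, by the linear systems of §3.2 requires (there the two geometries `e_s = −e_t`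
("straight") and `e_s ⟂ e_t` ("bent") have different series and the maximum is taken numerically: §4.1, "In Table 2 it
is also the case that straight `A` gives the maximum for the memory-2̃ bounds, although a priori there seems to be no
compelling reason to expect this").

## What the source prints (HSS93 = Hara–Slade–Sokal, J. Stat. Phys. 72 (1993) 479–517 = arXiv:hep-lat/9302003)

PDF p. 12 (printed p. 10), §2.4 "Inequalities (second version)": "For any memory `τ ≥ 2`, we can improve these results
by using (2.18)/(2.20), i.e. by taking into account the further constraint that the next-to-last site of the loop avoid
the next site of the backbone. The analysis given previously can be repeated almost verbatim in this case. We introduce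
`Π̃_τ(k;β) = max_{A,e} C̃^{A;e}_τ(0,0;β)` (2.36) where the maximum ranges over all `k`-element sets `A` which are the
range of a `(k−1)`-step self-avoiding walk starting at a nearest neighbour of the origin, and over all nearest neighbours
`e` of the origin satisfying `e ∉ A`."  PDF p. 13 (printed p. 11): "Arguing as before, we have
`μ ≥ μ_τ / Π̃_τ(k; μ_τ^{−1})` for `τ = 2, k ≥ 0, d > 0` (2.39)", with `μ₂ = 2d − 1` (§2.3).  PDF p. 22 (printed p. 20),
§4.1: the remark on the straight geometry quoted above.

## What is typed (standard axioms; no `sorry`; every generating function as PARTIAL SUMS)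

* `card_nbwAvoid_le_pen_sum`: the count-level fibre inequality `#nbwAvoid A n ≤ Σ_s Σ_{σ<n} #closedNbwPen A s σ ·
  #nbwAvoid ((A ∪ {0}) − e_s) (n−σ−1) + b_n(0)` (the tree's fibre bounds, summed);
* `sum_card_nbwAvoid_mul_pow_le_step`: its series form `Σ_{n≤K} #nbwAvoid A n βⁿ ≤ Σ_{n≤K} b_n(0) βⁿ +
  β Σ_s (Σ_{j<K} #closedNbwPen A s j β^j)(Σ_{j<K} #nbwAvoid ((A∪{0})−e_s) j β^j)` (`β ≥ 0`, any `A`);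
* `sum_card_nbwAvoid_mul_pow_le`: from the second pivot on (`0 ∉ A ∋ e_t`), if `Σ_{j≤K} b_j(0) β^j ≤ B₀` and
  `Σ_{j≤K} #closedNbwPen {e_t} s j β^j ≤ W` for all `t ≠ s` and all `K`, then
  `Σ_{n≤K} #nbwAvoid A n βⁿ ≤ B₀ Σ_{m≤K} #sawAvoid A m β^m W^m` (strong induction on `K`);
* `sum_card_nbwWords_mul_pow_le`: the first pivot, `Σ_{n≤K} b_n βⁿ ≤ B₀²(1 + W⁻¹) Σ_{m≤K} c_m β^m W^m`;
* **`hss_memoryTwo_series_div_le_connectiveConstant (hd : 3 ≤ d)`: if `W > 0` bounds the partial sums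
  `Σ_{j≤K} #closedNbwPen {e_t} s j (2d−1)^{−j}` for every pair of directions `t ≠ s` and every `K`, then
  `(2d−1)/W ≤ μ(ℤ^d)`** — (2.39) with `τ = 2`, `k = 1` and `Π̃₂(1;1/(2d−1))` replaced by any bound on the partial sums of
  the series whose maximum over `(A,e) = ({e_t}, e_s)` it is;
* `hss_memoryTwo_series_div_le_connectiveConstant_of_classes`: the same with the hypothesis split into the two
  geometries `s = −t` (straight) and `s ⟂ t` (bent: `s.1 ≠ t.1`) — for `t ≠ s` these are the only cases
  (`dir_eq_srev_of_ne_of_fst_eq`).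

NOT CLAIMED: the evaluation of the two series by the linear systems (2.40)/(3.12)–(3.18) and the decimal rows `(2̃,k)`
of Table 2; memories `τ ≥ 4`; `k ≥ 2`.  Label (proposed): PORT of (2.36)+(2.39) [`τ = 2`, `k = 1`, `Π̃` as a
hypothesis-bounded partial sum, maximum over the geometry at SERIES level]; a child of `SAWLoopErasureMemoryTwo` (tree).
-/

noncomputable section

namespace Literature.Probability.RandomPlanarGeometry.SAW.Zd.LoopErasure

open Finset Filter Topology
open scoped BigOperators
open Literature.Probability.LatticeModels Literature.Probability.LatticeModels.SRW
open Literature.Barriers.CriticalPhenomena Literature.Barriers.CriticalPhenomena.SAWLace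
open Literature.Probability.FitznerVanDerHofstad2017
open Literature.Probability.Percolation (IsNBW nbwWords nbwWordsTo mem_nbwWords srev srev_srev)

variable {d : ℕ}

/-! ### The fibre inequality, summed over the fibres -/

/-- **`#nbwAvoid A n ≤ Σ_s Σ_{σ<n} #closedNbwPen A s σ · #nbwAvoid ((A∪{0}) − e_s) (n−σ−1) + b_n(0)`**: split an
`n`-step NBW word avoiding `A` at its last visit `σ` to the origin — a penalised closed loop, the next step `s`, a tail
avoiding the shifted obstacle (`σ < n`), or a closed loop (`σ = n`).
[cite: HaraSladeSokal1993, §2.4 eq. (2.36)–(2.37) p. 10 (the next-to-last site of the loop avoids the next site of the backbone)] -/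
theorem card_nbwAvoid_le_pen_sum (A : Finset (Site d)) (n : ℕ) :
    (nbwAvoid A n).card ≤
      (∑ s : Dir d, ∑ σ ∈ range n,
        (closedNbwPen A s σ).card * (nbwAvoid (shiftSet A s) (n - σ - 1)).card) + nbwLoopsAll d n := by
  have hfib : ∀ σ ∈ range n, (lastFiberN A n σ).card ≤
      ∑ s : Dir d, (closedNbwPen A s σ).card * (nbwAvoid (shiftSet A s) (n - σ - 1)).card := by
    intro σ hσ
    rw [Finset.mem_range] at hσ
    rw [card_lastFiberN_congr (show n = σ + (1 + (n - σ - 1)) by omega)]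
    exact card_lastFiberN_le A σ (n - σ - 1)
  calc (nbwAvoid A n).card ≤ ∑ σ ∈ range (n + 1), (lastFiberN A n σ).card := card_nbwAvoid_le_sum A n
    _ = ∑ σ ∈ range n, (lastFiberN A n σ).card + (lastFiberN A n n).card := Finset.sum_range_succ _ _
    _ ≤ ∑ σ ∈ range n, ∑ s : Dir d, (closedNbwPen A s σ).card * (nbwAvoid (shiftSet A s) (n - σ - 1)).card +
          nbwLoopsAll d n := add_le_add (Finset.sum_le_sum hfib) (card_lastFiberN_self_le A n)
    _ = _ := by rw [Finset.sum_comm]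

/-! ### Series-level bookkeeping -/

/-- `Σ_{n≤K} (Σ_{σ<n} a_σ b_{n−σ−1}) βⁿ ≤ β (Σ_{j<K} a_j β^j)(Σ_{j<K} b_j β^j)` for `β ≥ 0` (a shifted convolution of
natural-number sequences, truncated). [cite: HaraSladeSokal1993, §2.4 eq. (2.37)–(2.38) p. 10 (lane plumbing: products of generating functions)] -/
theorem sum_shift_convolution_mul_pow_le {β : ℝ} (hβ : 0 ≤ β) (a b : ℕ → ℕ) (K : ℕ) :
    ∑ n ∈ range (K + 1), (∑ σ ∈ range n, (a σ : ℝ) * (b (n - σ - 1) : ℝ)) * β ^ n ≤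
      β * ((∑ j ∈ range K, (a j : ℝ) * β ^ j) * ∑ j ∈ range K, (b j : ℝ) * β ^ j) := by
  cases K with
  | zero => simp
  | succ K =>
    have h := sum_convolution_mul_pow_le hβ a b K
    push_cast at h
    rw [Finset.sum_range_succ' _ (K + 1)]
    simp only [Finset.range_zero, Finset.sum_empty, zero_mul, add_zero]
    calc ∑ k ∈ range (K + 1), (∑ σ ∈ range (k + 1), (a σ : ℝ) * (b (k + 1 - σ - 1) : ℝ)) * β ^ (k + 1)
        = β * ∑ k ∈ range (K + 1), (∑ σ ∈ range (k + 1), (a σ : ℝ) * (b (k - σ) : ℝ)) * β ^ k := by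
          rw [Finset.mul_sum]
          refine Finset.sum_congr rfl fun k _ => ?_
          rw [Finset.sum_congr rfl fun σ _ => by rw [show k + 1 - σ - 1 = k - σ by omega], pow_succ]
          ring
      _ ≤ β * ((∑ σ ∈ range (K + 1), (a σ : ℝ) * β ^ σ) * ∑ j ∈ range (K + 1), (b j : ℝ) * β ^ j) :=
          mul_le_mul_of_nonneg_left h hβ

/-- **The series form of the fibre inequality**: for `β ≥ 0` and any obstacle `A`,
`Σ_{n≤K} #nbwAvoid A n βⁿ ≤ Σ_{n≤K} b_n(0) βⁿ + β Σ_s (Σ_{j<K} #closedNbwPen A s j β^j)(Σ_{j<K} #nbwAvoid ((A∪{0})−e_s) j β^j)`.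
[cite: HaraSladeSokal1993, §2.4 eq. (2.36)–(2.38) p. 10 (C̃^{A;e}_τ(0,0;β) times the generating function of the tails)] -/
theorem sum_card_nbwAvoid_mul_pow_le_step {β : ℝ} (hβ : 0 ≤ β) (A : Finset (Site d)) (K : ℕ) :
    ∑ n ∈ range (K + 1), ((nbwAvoid A n).card : ℝ) * β ^ n ≤
      ∑ n ∈ range (K + 1), (nbwLoopsAll d n : ℝ) * β ^ n +
        β * ∑ s : Dir d, (∑ j ∈ range K, ((closedNbwPen A s j).card : ℝ) * β ^ j) *
          ∑ j ∈ range K, ((nbwAvoid (shiftSet A s) j).card : ℝ) * β ^ j := by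
  have hpt : ∀ n, ((nbwAvoid A n).card : ℝ) ≤
      (∑ s : Dir d, ∑ σ ∈ range n,
        ((closedNbwPen A s σ).card : ℝ) * ((nbwAvoid (shiftSet A s) (n - σ - 1)).card : ℝ)) +
        (nbwLoopsAll d n : ℝ) := fun n => by exact_mod_cast card_nbwAvoid_le_pen_sum A n
  have hconv : ∀ s : Dir d,
      ∑ n ∈ range (K + 1), (∑ σ ∈ range n,
        ((closedNbwPen A s σ).card : ℝ) * ((nbwAvoid (shiftSet A s) (n - σ - 1)).card : ℝ)) * β ^ n ≤
        β * ((∑ j ∈ range K, ((closedNbwPen A s j).card : ℝ) * β ^ j) *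
          ∑ j ∈ range K, ((nbwAvoid (shiftSet A s) j).card : ℝ) * β ^ j) := fun s =>
    sum_shift_convolution_mul_pow_le hβ (fun j => (closedNbwPen A s j).card)
      (fun j => (nbwAvoid (shiftSet A s) j).card) K
  calc ∑ n ∈ range (K + 1), ((nbwAvoid A n).card : ℝ) * β ^ n
      ≤ ∑ n ∈ range (K + 1), ((∑ s : Dir d, ∑ σ ∈ range n,
          ((closedNbwPen A s σ).card : ℝ) * ((nbwAvoid (shiftSet A s) (n - σ - 1)).card : ℝ)) +
          (nbwLoopsAll d n : ℝ)) * β ^ n :=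
        Finset.sum_le_sum fun n _ => mul_le_mul_of_nonneg_right (hpt n) (pow_nonneg hβ _)
    _ = (∑ s : Dir d, ∑ n ∈ range (K + 1), (∑ σ ∈ range n,
          ((closedNbwPen A s σ).card : ℝ) * ((nbwAvoid (shiftSet A s) (n - σ - 1)).card : ℝ)) * β ^ n) +
          ∑ n ∈ range (K + 1), (nbwLoopsAll d n : ℝ) * β ^ n := by
        rw [Finset.sum_comm, ← Finset.sum_add_distrib]
        refine Finset.sum_congr rfl fun n _ => ?_
        rw [add_mul, Finset.sum_mul]
    _ ≤ (∑ s : Dir d, β * ((∑ j ∈ range K, ((closedNbwPen A s j).card : ℝ) * β ^ j) *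
          ∑ j ∈ range K, ((nbwAvoid (shiftSet A s) j).card : ℝ) * β ^ j)) +
          ∑ n ∈ range (K + 1), (nbwLoopsAll d n : ℝ) * β ^ n :=
        add_le_add (Finset.sum_le_sum fun s _ => hconv s) le_rfl
    _ = _ := by rw [← Finset.mul_sum, add_comm]

/-! ### The series-level decoration inequality -/

/-- **The memory-2 loop erasure from the second pivot on, at series level.**  Let `β ≥ 0`, `W ≥ 0`, and suppose
`Σ_{j≤K} b_j(0) β^j ≤ B₀` and `Σ_{j≤K} #closedNbwPen {e_t} s j β^j ≤ W` for all directions `t ≠ s` and all `K`.  Then for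
every obstacle `A` with `0 ∉ A` containing a neighbour `e_t` of the origin,
`Σ_{n≤K} #nbwAvoid A n βⁿ ≤ B₀ · Σ_{m≤K} #sawAvoid A m β^m W^m`: every NBW word avoiding `A` is a SAW avoiding `A`
decorated with closed NBW loops, each but the last avoiding the previous pivot and not ending with the reversal of the
next backbone step — its generating function at most `max_{A',e} C̃^{A';e}₂(0,0;β) ≤ W` by monotonicity in the obstacle.
[cite: HaraSladeSokal1993, §2.4 eq. (2.36)–(2.38) p. 10 (τ = 2, k = 1; Π̃ = max over the geometry of the SERIES)] -/
theorem sum_card_nbwAvoid_mul_pow_le {β W B₀ : ℝ} (hβ : 0 ≤ β) (hW0 : 0 ≤ W)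
    (hB₀ : ∀ K : ℕ, ∑ j ∈ range (K + 1), (nbwLoopsAll d j : ℝ) * β ^ j ≤ B₀)
    (hW : ∀ t s : Dir d, t ≠ s → ∀ K : ℕ,
      ∑ j ∈ range (K + 1), ((closedNbwPen {stepVec t} s j).card : ℝ) * β ^ j ≤ W)
    (K : ℕ) : ∀ A : Finset (Site d), (0 : Site d) ∉ A → (∃ t : Dir d, stepVec t ∈ A) →
    ∑ n ∈ range (K + 1), ((nbwAvoid A n).card : ℝ) * β ^ n ≤
      B₀ * ∑ m ∈ range (K + 1), ((sawAvoid A m).card : ℝ) * β ^ m * W ^ m := by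
  induction K using Nat.strong_induction_on with
  | _ K ih =>
  intro A h0 hA
  obtain ⟨t, ht⟩ := hA
  have hB₀0 : 0 ≤ B₀ :=
    (Finset.sum_nonneg fun j _ => mul_nonneg (Nat.cast_nonneg _) (pow_nonneg hβ _)).trans (hB₀ 0)
  -- the loop series at this pivot
  have hloop : ∀ s : Dir d, stepVec s ∉ A →
      ∑ j ∈ range K, ((closedNbwPen A s j).card : ℝ) * β ^ j ≤ W := by
    intro s hs
    have hts : t ≠ s := by
      rintro rfl
      exact hs ht
    have hmono : ∑ j ∈ range K, ((closedNbwPen A s j).card : ℝ) * β ^ j ≤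
        ∑ j ∈ range K, ((closedNbwPen {stepVec t} s j).card : ℝ) * β ^ j :=
      Finset.sum_le_sum fun j _ => mul_le_mul_of_nonneg_right
        (by exact_mod_cast card_closedNbwPen_mono (Finset.singleton_subset_iff.2 ht) s j) (pow_nonneg hβ _)
    refine hmono.trans ?_
    cases K with
    | zero => simpa using hW0
    | succ K' => exact hW t s hts K'
  -- the tail series (induction hypothesis)
  have htail : ∀ s : Dir d, (0 : Site d) ∉ shiftSet A s →
      ∑ j ∈ range K, ((nbwAvoid (shiftSet A s) j).card : ℝ) * β ^ j ≤
        B₀ * ∑ m ∈ range K, ((sawAvoid (shiftSet A s) m).card : ℝ) * β ^ m * W ^ m := by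
    intro s hs
    cases K with
    | zero => simp
    | succ K' =>
      exact ih K' (by omega) (shiftSet A s) hs ⟨s.neg, by rw [stepVec_neg]; exact neg_stepVec_mem_shiftSet A s⟩
  -- per next step `s`
  have hterm : ∀ s : Dir d,
      (∑ j ∈ range K, ((closedNbwPen A s j).card : ℝ) * β ^ j) *
          ∑ j ∈ range K, ((nbwAvoid (shiftSet A s) j).card : ℝ) * β ^ j ≤
        W * (B₀ * ∑ m ∈ range K, ((sawAvoid (shiftSet A s) m).card : ℝ) * β ^ m * W ^ m) := by
    intro s
    have hR0 : 0 ≤ W * (B₀ * ∑ m ∈ range K, ((sawAvoid (shiftSet A s) m).card : ℝ) * β ^ m * W ^ m) :=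
      mul_nonneg hW0 (mul_nonneg hB₀0 (Finset.sum_nonneg fun m _ =>
        mul_nonneg (mul_nonneg (Nat.cast_nonneg _) (pow_nonneg hβ _)) (pow_nonneg hW0 _)))
    by_cases h0s : (0 : Site d) ∈ shiftSet A s
    · have hz : ∑ j ∈ range K, ((nbwAvoid (shiftSet A s) j).card : ℝ) * β ^ j = 0 := by
        refine Finset.sum_eq_zero fun j _ => ?_
        rw [nbwAvoid_eq_empty_of_mem h0s, Finset.card_empty, Nat.cast_zero, zero_mul]
      rw [hz, mul_zero]
      exact hR0
    · have hs : stepVec s ∉ A := by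
        intro hmem
        apply h0s
        rw [mem_shiftSet, zero_add]
        exact Finset.mem_insert_of_mem hmem
      exact mul_le_mul (hloop s hs) (htail s h0s)
        (Finset.sum_nonneg fun j _ => mul_nonneg (Nat.cast_nonneg _) (pow_nonneg hβ _)) hW0
  -- summing over `s` and shifting the backbone
  have hsum : ∑ s : Dir d, (∑ j ∈ range K, ((closedNbwPen A s j).card : ℝ) * β ^ j) *
        ∑ j ∈ range K, ((nbwAvoid (shiftSet A s) j).card : ℝ) * β ^ j ≤
      W * (B₀ * ∑ m ∈ range K, ((sawAvoid A (m + 1)).card : ℝ) * β ^ m * W ^ m) := by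
    refine (Finset.sum_le_sum fun s _ => hterm s).trans ?_
    rw [← Finset.mul_sum, ← Finset.mul_sum]
    refine mul_le_mul_of_nonneg_left (mul_le_mul_of_nonneg_left ?_ hB₀0) hW0
    rw [Finset.sum_comm]
    refine Finset.sum_le_sum fun m _ => ?_
    rw [← Finset.sum_mul, ← Finset.sum_mul]
    refine mul_le_mul_of_nonneg_right (mul_le_mul_of_nonneg_right ?_ (pow_nonneg hβ _)) (pow_nonneg hW0 _)
    exact_mod_cast sum_card_sawAvoid_shift_le h0 m
  -- assembling
  have hfirst : ∑ n ∈ range (K + 1), (nbwLoopsAll d n : ℝ) * β ^ n ≤ B₀ := hB₀ K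
  have hsplit : B₀ * ∑ m ∈ range (K + 1), ((sawAvoid A m).card : ℝ) * β ^ m * W ^ m =
      B₀ + β * (W * (B₀ * ∑ m ∈ range K, ((sawAvoid A (m + 1)).card : ℝ) * β ^ m * W ^ m)) := by
    rw [Finset.sum_range_succ' _ K, card_sawAvoid_zero h0, Nat.cast_one, pow_zero, pow_zero, mul_one, mul_one,
      mul_add, mul_one, add_comm]
    simp only [Finset.mul_sum]
    congr 1
    refine Finset.sum_congr rfl fun m _ => ?_
    rw [pow_succ, pow_succ]
    ring
  rw [hsplit]
  refine (sum_card_nbwAvoid_mul_pow_le_step hβ A K).trans ?_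
  exact add_le_add hfirst (mul_le_mul_of_nonneg_left hsum hβ)

/-- **The first pivot, at series level**: with `B₀ ≥ Σ_{j≤K} b_j(0) β^j` (all `K`) and `W > 0` bounding every penalised
loop series `Σ_{j≤K} #closedNbwPen {e_t} s j β^j` (`t ≠ s`),
`Σ_{n≤K} b_n βⁿ ≤ B₀²(1 + W⁻¹) Σ_{m≤K} c_m β^m W^m` (the loop at the first pivot and the last loop are free).
[cite: HaraSladeSokal1993, §2.4 eq. (2.37)–(2.38) p. 10 (summed over x; τ = 2, k = 1)] -/
theorem sum_card_nbwWords_mul_pow_le {β W B₀ : ℝ} (hβ : 0 ≤ β) (hW0 : 0 < W)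
    (hB₀ : ∀ K : ℕ, ∑ j ∈ range (K + 1), (nbwLoopsAll d j : ℝ) * β ^ j ≤ B₀)
    (hW : ∀ t s : Dir d, t ≠ s → ∀ K : ℕ,
      ∑ j ∈ range (K + 1), ((closedNbwPen {stepVec t} s j).card : ℝ) * β ^ j ≤ W) (K : ℕ) :
    ∑ n ∈ range (K + 1), ((nbwWords d n).card : ℝ) * β ^ n ≤
      B₀ * B₀ * (1 + W⁻¹) * ∑ m ∈ range (K + 1), (count d m : ℝ) * β ^ m * W ^ m := by
  have h0 : (0 : Site d) ∉ (∅ : Finset (Site d)) := Finset.notMem_empty _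
  have hB₀1 : 1 ≤ B₀ := by
    have h := hB₀ 0
    rw [Finset.sum_range_one, pow_zero, mul_one, nbwLoopsAll_zero] at h
    exact h
  have hB₀0 : 0 ≤ B₀ := by linarith
  have hWi : 0 ≤ W⁻¹ := inv_nonneg.2 hW0.le
  -- the loop series at the first pivot is at most `B₀`
  have hloop : ∀ s : Dir d, ∑ j ∈ range K, ((closedNbwPen (∅ : Finset (Site d)) s j).card : ℝ) * β ^ j ≤ B₀ := by
    intro s
    calc ∑ j ∈ range K, ((closedNbwPen (∅ : Finset (Site d)) s j).card : ℝ) * β ^ j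
        ≤ ∑ j ∈ range (K + 1), ((closedNbwPen (∅ : Finset (Site d)) s j).card : ℝ) * β ^ j :=
          Finset.sum_le_sum_of_subset_of_nonneg (Finset.range_mono (Nat.le_succ K))
            fun j _ _ => mul_nonneg (Nat.cast_nonneg _) (pow_nonneg hβ _)
      _ ≤ ∑ j ∈ range (K + 1), (nbwLoopsAll d j : ℝ) * β ^ j :=
          Finset.sum_le_sum fun j _ => mul_le_mul_of_nonneg_right
            (by exact_mod_cast card_closedNbwPen_le_nbwLoopsAll _ s j) (pow_nonneg hβ _)
      _ ≤ B₀ := hB₀ K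
  -- the tail series
  have htail : ∀ s : Dir d, (0 : Site d) ∉ shiftSet (∅ : Finset (Site d)) s →
      ∑ j ∈ range K, ((nbwAvoid (shiftSet (∅ : Finset (Site d)) s) j).card : ℝ) * β ^ j ≤
        B₀ * ∑ m ∈ range K, ((sawAvoid (shiftSet (∅ : Finset (Site d)) s) m).card : ℝ) * β ^ m * W ^ m := by
    intro s hs
    cases K with
    | zero => simp
    | succ K' =>
      exact sum_card_nbwAvoid_mul_pow_le hβ hW0.le hB₀ hW K' _ hs
        ⟨s.neg, by rw [stepVec_neg]; exact neg_stepVec_mem_shiftSet _ s⟩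
  have hterm : ∀ s : Dir d,
      (∑ j ∈ range K, ((closedNbwPen (∅ : Finset (Site d)) s j).card : ℝ) * β ^ j) *
          ∑ j ∈ range K, ((nbwAvoid (shiftSet (∅ : Finset (Site d)) s) j).card : ℝ) * β ^ j ≤
        B₀ * (B₀ * ∑ m ∈ range K, ((sawAvoid (shiftSet (∅ : Finset (Site d)) s) m).card : ℝ) * β ^ m * W ^ m) := by
    intro s
    have hR0 : 0 ≤ B₀ * (B₀ * ∑ m ∈ range K,
        ((sawAvoid (shiftSet (∅ : Finset (Site d)) s) m).card : ℝ) * β ^ m * W ^ m) :=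
      mul_nonneg hB₀0 (mul_nonneg hB₀0 (Finset.sum_nonneg fun m _ =>
        mul_nonneg (mul_nonneg (Nat.cast_nonneg _) (pow_nonneg hβ _)) (pow_nonneg hW0.le _)))
    by_cases h0s : (0 : Site d) ∈ shiftSet (∅ : Finset (Site d)) s
    · have hz : ∑ j ∈ range K, ((nbwAvoid (shiftSet (∅ : Finset (Site d)) s) j).card : ℝ) * β ^ j = 0 := by
        refine Finset.sum_eq_zero fun j _ => ?_
        rw [nbwAvoid_eq_empty_of_mem h0s, Finset.card_empty, Nat.cast_zero, zero_mul]
      rw [hz, mul_zero]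
      exact hR0
    · exact mul_le_mul (hloop s) (htail s h0s)
        (Finset.sum_nonneg fun j _ => mul_nonneg (Nat.cast_nonneg _) (pow_nonneg hβ _)) hB₀0
  have hsum : ∑ s : Dir d, (∑ j ∈ range K, ((closedNbwPen (∅ : Finset (Site d)) s j).card : ℝ) * β ^ j) *
        ∑ j ∈ range K, ((nbwAvoid (shiftSet (∅ : Finset (Site d)) s) j).card : ℝ) * β ^ j ≤
      B₀ * (B₀ * ∑ m ∈ range K, (count d (m + 1) : ℝ) * β ^ m * W ^ m) := by
    refine (Finset.sum_le_sum fun s _ => hterm s).trans ?_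
    rw [← Finset.mul_sum, ← Finset.mul_sum]
    refine mul_le_mul_of_nonneg_left (mul_le_mul_of_nonneg_left ?_ hB₀0) hB₀0
    rw [Finset.sum_comm]
    refine Finset.sum_le_sum fun m _ => ?_
    rw [← Finset.sum_mul, ← Finset.sum_mul, ← card_sawAvoid_empty (m + 1)]
    refine mul_le_mul_of_nonneg_right (mul_le_mul_of_nonneg_right ?_ (pow_nonneg hβ _)) (pow_nonneg hW0.le _)
    exact_mod_cast sum_card_sawAvoid_shift_le h0 m
  -- the comparison sum `S = Σ_{m≤K} c_m β^m W^m ≥ 1`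
  set S : ℝ := ∑ m ∈ range (K + 1), (count d m : ℝ) * β ^ m * W ^ m with hSdef
  have hc0 : (count d 0 : ℝ) = 1 := by
    rw [← card_sawAvoid_empty 0, card_sawAvoid_zero h0, Nat.cast_one]
  have hS : S = 1 + W * (β * ∑ m ∈ range K, (count d (m + 1) : ℝ) * β ^ m * W ^ m) := by
    rw [hSdef, Finset.sum_range_succ' _ K, hc0, pow_zero, pow_zero, mul_one, mul_one, add_comm, Finset.mul_sum,
      Finset.mul_sum]
    congr 1
    refine Finset.sum_congr rfl fun m _ => ?_
    rw [pow_succ, pow_succ]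
    ring
  have hT0 : 0 ≤ β * ∑ m ∈ range K, (count d (m + 1) : ℝ) * β ^ m * W ^ m :=
    mul_nonneg hβ (Finset.sum_nonneg fun m _ =>
      mul_nonneg (mul_nonneg (Nat.cast_nonneg _) (pow_nonneg hβ _)) (pow_nonneg hW0.le _))
  have hS1 : 1 ≤ S := by
    rw [hS]
    nlinarith [mul_nonneg hW0.le hT0]
  have hTS : β * ∑ m ∈ range K, (count d (m + 1) : ℝ) * β ^ m * W ^ m ≤ W⁻¹ * S := by
    have e : β * ∑ m ∈ range K, (count d (m + 1) : ℝ) * β ^ m * W ^ m = W⁻¹ * (S - 1) := by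
      rw [hS, add_sub_cancel_left, ← mul_assoc, inv_mul_cancel₀ hW0.ne', one_mul]
    rw [e]
    exact mul_le_mul_of_nonneg_left (by linarith) hWi
  calc ∑ n ∈ range (K + 1), ((nbwWords d n).card : ℝ) * β ^ n
      = ∑ n ∈ range (K + 1), ((nbwAvoid (∅ : Finset (Site d)) n).card : ℝ) * β ^ n := by
        refine Finset.sum_congr rfl fun n _ => ?_
        rw [card_nbwAvoid_empty]
    _ ≤ ∑ n ∈ range (K + 1), (nbwLoopsAll d n : ℝ) * β ^ n +
          β * ∑ s : Dir d, (∑ j ∈ range K, ((closedNbwPen (∅ : Finset (Site d)) s j).card : ℝ) * β ^ j) *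
            ∑ j ∈ range K, ((nbwAvoid (shiftSet (∅ : Finset (Site d)) s) j).card : ℝ) * β ^ j :=
        sum_card_nbwAvoid_mul_pow_le_step hβ _ K
    _ ≤ B₀ + β * (B₀ * (B₀ * ∑ m ∈ range K, (count d (m + 1) : ℝ) * β ^ m * W ^ m)) :=
        add_le_add (hB₀ K) (mul_le_mul_of_nonneg_left hsum hβ)
    _ = B₀ + B₀ * B₀ * (β * ∑ m ∈ range K, (count d (m + 1) : ℝ) * β ^ m * W ^ m) := by ring
    _ ≤ B₀ * B₀ * S + B₀ * B₀ * (W⁻¹ * S) := by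
        refine add_le_add ?_ (mul_le_mul_of_nonneg_left hTS (mul_nonneg hB₀0 hB₀0))
        nlinarith [mul_nonneg hB₀0 hB₀0, mul_le_mul hB₀1 hS1 zero_le_one hB₀0]
    _ = B₀ * B₀ * (1 + W⁻¹) * S := by ring

/-! ### The bound on `μ(ℤ^d)` at `β = 1/(2d−1)` -/

/-- **Hara–Slade–Sokal (2.36)+(2.39) with `τ = 2`, `k = 1`, the maximum over the geometry taken at the level of the
series: `μ(ℤ^d) ≥ (2d − 1)/W`** for every `d ≥ 3` and every `W > 0` bounding, for EACH pair of directions `t ≠ s`,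
the partial sums `Σ_{j≤K} #closedNbwPen {e_t} s j (2d−1)^{−j}` of the generating function `C̃^{{e_t};e_s}₂(0,0;1/(2d−1))`
of the closed NBW loops at `0` avoiding `e_t` whose next-to-last site is not `e_s`.  AS PRINTED: "`Π̃_τ(k;β) =
max_{A,e} C̃^{A;e}_τ(0,0;β)` (2.36) … Arguing as before, we have `μ ≥ μ_τ/Π̃_τ(k; μ_τ^{−1})` (2.39)", `μ₂ = 2d − 1`.
[cite: HaraSladeSokal1993, §2.4 eq. (2.36) p. 10 and eq. (2.39) p. 11 (τ = 2, k = 1), with (2.14) p. 6 for the free loops] -/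
theorem hss_memoryTwo_series_div_le_connectiveConstant (hd : 3 ≤ d) {W : ℝ} (hW0 : 0 < W)
    (hW : ∀ t s : Dir d, t ≠ s → ∀ K : ℕ,
      ∑ j ∈ range (K + 1), ((closedNbwPen {stepVec t} s j).card : ℝ) * (1 / (2 * (d : ℝ) - 1)) ^ j ≤ W) :
    (2 * (d : ℝ) - 1) / W ≤ connectiveConstant d := by
  set β : ℝ := 1 / (2 * (d : ℝ) - 1) with hβdef
  set B₀ : ℝ := (2 * (d : ℝ) - 2) / (2 * (d : ℝ) - 1) * srwI d 1 0 0 with hB₀def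
  have hd3 : (3 : ℝ) ≤ d := by exact_mod_cast hd
  have hpos : (0 : ℝ) < 2 * (d : ℝ) - 1 := by linarith
  have hβ0 : 0 < β := one_div_pos.2 hpos
  have hB₀ : ∀ K, ∑ j ∈ range (K + 1), (nbwLoopsAll d j : ℝ) * β ^ j ≤ B₀ := fun K =>
    sum_nbwLoopsAll_mul_pow_le hd K
  have hB₀1 : 1 ≤ B₀ := by
    have h := hB₀ 0
    rw [Finset.sum_range_one, pow_zero, mul_one, nbwLoopsAll_zero] at h
    exact h
  have hB₀0 : 0 ≤ B₀ := by linarith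
  set C : ℝ := B₀ * B₀ * (1 + W⁻¹) with hCdef
  have hC : 0 ≤ C := mul_nonneg (mul_nonneg hB₀0 hB₀0) (by linarith [inv_nonneg.2 hW0.le])
  have key : 1 / (β * W) ≤ connectiveConstant d := by
    refine div_le_connectiveConstant_of (by omega) hβ0 hC hW0 fun N => ?_
    have hN : (N : ℝ) + 1 ≤ ∑ n ∈ range (N + 1), ((nbwWords d n).card : ℝ) * β ^ n := by
      have h1 : (N : ℝ) + 1 = ∑ _n ∈ range (N + 1), (1 : ℝ) := by simp
      rw [h1]
      exact Finset.sum_le_sum fun n _ => one_le_card_nbwWords_mul_pow (by omega) n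
    refine hN.trans ((sum_card_nbwWords_mul_pow_le hβ0.le hW0 hB₀ hW N).trans (le_of_eq ?_))
    rw [Finset.mul_sum]
    refine Finset.sum_congr rfl fun m _ => ?_
    ring
  have e : 1 / (β * W) = (2 * (d : ℝ) - 1) / W := by
    rw [hβdef]
    field_simp
  rw [← e]
  exact key

/-- For directions `t ≠ s` with the same axis, `s` is the reversal of `t`. [cite: MadrasSlade1993, §1.2 (the 2d steps ±e_i; lane plumbing)] -/
theorem dir_eq_srev_of_ne_of_fst_eq {t s : Dir d} (hts : t ≠ s) (h1 : s.1 = t.1) : s = srev t := by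
  obtain ⟨s₁, s₂⟩ := s
  obtain ⟨t₁, t₂⟩ := t
  simp only at h1
  subst h1
  have h2 : s₂ ≠ t₂ := fun h => hts (by rw [h])
  show (s₁, s₂) = (s₁, !t₂)
  cases s₂ <;> cases t₂ <;> simp_all

/-- **The two geometries.**  `μ(ℤ^d) ≥ (2d−1)/W` (`d ≥ 3`, `W > 0`) as soon as `W` bounds the partial sums of the
penalised loop series for the STRAIGHT geometry (`e_s = −e_t`: the backbone goes straight through the pivot) and for
the BENT one (`e_s ⟂ e_t`): for `t ≠ s` these are the only cases.  (By lattice symmetry each of the two series is the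
same for all its pairs `(t,s)`; which of the two is larger is decided numerically in the source: "in (3.18) straight `A`
will give the maximum individually for each of `C^A_2(0,0;β)` and `C^A_2(0,e;β)`, but possibly not for the difference".)
[cite: HaraSladeSokal1993, §2.4 eq. (2.36)+(2.39) p. 10–11; §4.1 p. 20 (straight vs. bent geometry)] -/
theorem hss_memoryTwo_series_div_le_connectiveConstant_of_classes (hd : 3 ≤ d) {W : ℝ} (hW0 : 0 < W)
    (hWs : ∀ t : Dir d, ∀ K : ℕ,
      ∑ j ∈ range (K + 1), ((closedNbwPen {stepVec t} (srev t) j).card : ℝ) * (1 / (2 * (d : ℝ) - 1)) ^ j ≤ W)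
    (hWb : ∀ t s : Dir d, s.1 ≠ t.1 → ∀ K : ℕ,
      ∑ j ∈ range (K + 1), ((closedNbwPen {stepVec t} s j).card : ℝ) * (1 / (2 * (d : ℝ) - 1)) ^ j ≤ W) :
    (2 * (d : ℝ) - 1) / W ≤ connectiveConstant d := by
  refine hss_memoryTwo_series_div_le_connectiveConstant hd hW0 fun t s hts K => ?_
  by_cases h1 : s.1 = t.1
  · rw [dir_eq_srev_of_ne_of_fst_eq hts h1]
    exact hWs t K
  · exact hWb t s h1 K

end Literature.Probability.RandomPlanarGeometry.SAW.Zd.LoopErasure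

end
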